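import Literature.NumberTheory.Sieve.ChenTheoremIAssembly
import Literature.NumberTheory.Sieve.ChenTheoremISieveProduct
import Literature.NumberTheory.Sieve.ChenTheoremISiftedLower
import Literature.NumberTheory.Sieve.ChenTheoremISiftedDvdUpper
import Literature.NumberTheory.Sieve.ChenTheoremINumerics
import Literature.NumberTheory.Sieve.ChenTheoremISwitchedSieve
import Literature.NumberTheory.Sieve.ChenTheoremISwitchedRemainder
import Literature.NumberTheory.Sieve.ChenTheoremISwitchedCount
import HarnessLib

/-!
# Chen's Theorem I as printed — `P_x(1,2) ≥ 0.67 x C_x/(log x)²` — PROVED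

This file DISCHARGES the named fact `Literature.NumberTheory.Sieve.Chen.Chen1973_theoremI` of
`ChenTheorem.lean` (Chen Jing-run, *On the representation of a larger even integer as the sum of a
prime and the product of at most two primes*, Sci. Sinica 16 (1973) 157–176, Theorem I; held copy:
Wang Yuan (ed.), *Goldbach Conjecture*, World Scientific 1984, PDF p. 150):

> every sufficiently large even `x` satisfies `P_x(1,2) ≥ 0.67 x C_x/(log x)²`,

`P_x(1,2) = #{p ≤ x : x − p = p₁ or p₂p₃}`, `C_x = ∏_{p ∣ x, p > 2} (p−1)/(p−2) ∏_{p > 2}(1 − 1/(p−1)²)`.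

The proof is Chen's (§III, PDF p. 168), assembled by `Chen1973_theoremI_of` (`ChenTheoremIAssembly`)
from the weighted-sieve inequality (34) at `z = x^{1/10}`, `y = x^{1/3}` and the three estimates

* (A) `S(A, 𝒫, x^{1/10}) ≥ (f(5) − ε) xV/log x` (`siftedCount_tenth_lower`, Lemma 9 first half:
  Iwaniec's linear sieve, Bombieri–Vinogradov);
* (B) `∑_{x^{1/10} ≤ q < x^{1/3}} S(A_q, 𝒫, x^{1/10}) ≤ (∫_{1/10}^{1/3} F(5−10β)dβ/β + ε) xV/log x`
  (`siftedCountDvd_tenth_sum_upper`, Lemma 9 second half);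
* (C) `S(B, 𝒫, x^{1/3}) ≤ ((2e^γ/5) c₁₀ + ε) xV/log x + O(x/(log x)³)`, `c₁₀ = ∫_{1/10}^{1/3} log(2−3α)dα/(α(1−α))`
  (`switchedSiftedCount_tenth_upper` below, Lemma 8: the sieve step `switchedSiftedCount_leT`, the
  bilinear remainder `switchedRemainderT_le` — Nathanson's Thm 10.7, the large sieve and Siegel–Walfisz —
  and the count `card_switchedTriplesT_le`);
* (V) `V(x^{1/10}) ≥ (1 − ε) 20e^{−γ} 𝔖(x)/log x` (`sieveProduct_tenth_lower`, Mertens);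

together with the numerical inequality `f(5) − b/2 − c/2 > 0.67 e^γ/20` (`chen_theoremI_mainInequality`:
Chen's `2.6408 − 1.9702 = 0.6706 ≥ 0.67`, here `≥ 0.676` with the exact sieve functions, i.e.
Halberstam–Richert's `0.689` up to Chen's crude bound in (33)).

Every input is a theorem of the tree (Bombieri–Vinogradov, Siegel–Walfisz, the Rosser–Iwaniec sieve,
Mertens' theorems, the prime number theorem are all PROVED there); the result is unconditional.

## References

* Chen Jing-run, Sci. Sinica 16 (1973) 157–176, Theorem I, Lemmas 8–9, §III (PDF pp. 150, 166–168 of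
  the held copy). [ChenSciSinica1973]
* H. Halberstam, H.-E. Richert, *Sieve Methods* (1974), Ch. 11, Thm 11.1.
* M. B. Nathanson, *Additive Number Theory: The Classical Bases*, GTM 164 (1996), Ch. 10. [Nathanson1996]
-/

open Finset Filter Topology

noncomputable section

namespace Literature.NumberTheory.Sieve.Chen

/-- The bookkeeping of the constant of (C): for `0 < G ≤ 3`, `0 ≤ c ≤ 1/2`, `0 < t ≤ 1/8`,
`(2G/(5(1 − 2t)) + t)(1 + t)²(c + t) ≤ (2G/5) c + 11 t`. [folklore] -/
theorem switched_coeff_le {G c t : ℝ} (hG0 : 0 < G) (hG3 : G ≤ 3) (hc0 : 0 ≤ c) (hc : c ≤ 1 / 2)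
    (ht0 : 0 < t) (ht : t ≤ 1 / 8) :
    (2 * G / (5 * (1 - 2 * t)) + t) * (1 + t) ^ 2 * (c + t) ≤ 2 * G / 5 * c + 11 * t := by
  have h12 : 0 < 1 - 2 * t := by linarith
  -- `2G/(5(1−2t)) ≤ 2G/5 + 5t`
  have hK : 2 * G / (5 * (1 - 2 * t)) ≤ 2 * G / 5 + 5 * t := by
    rw [div_le_iff₀ (by positivity)]
    nlinarith
  have hK0 : 0 ≤ 2 * G / (5 * (1 - 2 * t)) + t := by positivity
  -- `(1+t)²(c+t) ≤ c + 4t`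
  have hAB : (1 + t) ^ 2 * (c + t) ≤ c + 4 * t := by
    have h1 : (1 + t) ^ 2 ≤ 1 + 3 * t := by nlinarith
    have h2 : (1 + 3 * t) * (c + t) ≤ c + 4 * t := by nlinarith
    exact (mul_le_mul_of_nonneg_right h1 (by positivity)).trans h2
  have hAB0 : 0 ≤ (1 + t) ^ 2 * (c + t) := by positivity
  calc (2 * G / (5 * (1 - 2 * t)) + t) * (1 + t) ^ 2 * (c + t)
      = (2 * G / (5 * (1 - 2 * t)) + t) * ((1 + t) ^ 2 * (c + t)) := by ring
    _ ≤ (2 * G / 5 + 6 * t) * (c + 4 * t) :=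
        mul_le_mul (by linarith) hAB hAB0 (by positivity)
    _ ≤ 2 * G / 5 * c + 11 * t := by nlinarith

/-- **Chen's Lemma 8 (hypothesis (C) of `Chen1973_theoremI_of`), PROVED**: for every `ε > 0` there
are `C, x₀` with
`S(B, 𝒫, x^{1/3}) ≤ ((2e^γ/5) c₁₀ + ε) x V(x^{1/10})/log x + C x/(log x)³` for all even `x ≥ x₀`,
`B = {x − p₁p₂p₃ : x^{1/10} ≤ p₁ < x^{1/3} ≤ p₂ ≤ p₃}`, `c₁₀ = switchingConstantTenth`
(Chen: `Ω ≤ 3.9404 x C_x/(log x)²`; here `(2e^γ/5)c₁₀ · 20e^{−γ} = 8c₁₀ < 3.929`). Combination of the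
sieve step `switchedSiftedCount_leT` (`ε = δ = θ = t`), the remainder `switchedRemainderT_le` and the
count `card_switchedTriplesT_le` (`η = t`), with `t = min(1/8, ε/11)` (`switched_coeff_le`).
[cite: ChenSciSinica1973, Lemma 8] -/
theorem switchedSiftedCount_tenth_upper {ε : ℝ} (hε : 0 < ε) :
    ∃ C : ℝ, ∃ x₀ : ℕ, ∀ x : ℕ, x₀ ≤ x → Even x →
      (switchedSiftedCount x ((x : ℝ) ^ (1 / 10 : ℝ)) (y x) : ℝ) ≤
        (2 * Real.exp Real.eulerMascheroniConstant / 5 * switchingConstantTenth + ε) *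
            ((x : ℝ) * sieveProduct x ((x : ℝ) ^ (1 / 10 : ℝ)) / Real.log x) +
          C * (x : ℝ) / Real.log x ^ 3 := by
  have hc0 : 0 ≤ switchingConstantTenth := switchingConstantTenth_nonneg
  have hc2 : switchingConstantTenth ≤ 1 / 2 := by
    have := switchingConstantTenth_lt
    norm_num at this
    linarith
  have hG0 : 0 < Real.exp Real.eulerMascheroniConstant := Real.exp_pos _
  have hG3 : Real.exp Real.eulerMascheroniConstant ≤ 3 := by
    have h1 : Real.exp Real.eulerMascheroniConstant ≤ Real.exp 1 :=
      Real.exp_le_exp.mpr (Real.eulerMascheroniConstant_lt_two_thirds.le.trans (by norm_num))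
    have h2 := Real.exp_one_lt_d9
    linarith
  set t := min (1 / 8) (ε / 11) with ht
  have ht0 : 0 < t := lt_min (by norm_num) (by positivity)
  have ht8 : t ≤ 1 / 8 := min_le_left _ _
  have ht11 : 11 * t ≤ ε := by
    have := min_le_right (1 / 8 : ℝ) (ε / 11)
    rw [← ht] at this
    linarith
  have ht1 : t ≤ 1 := by linarith
  have ht4 : t ≤ 1 / 4 := by linarith
  have h12 : 0 < 1 - 2 * t := by linarith
  have hS := switchedSiftedCount_leT (ε := t) (δ := t) (θ := t) ht0 ht1 ht0 ht8 ht0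
  have hT := card_switchedTriplesT_le (ε := t) ht0 ht1 (η := t) ht0
  obtain ⟨C, hR⟩ := switchedRemainderT_le (ε := t) (δ := t) ht0 ht1 ht0 ht4
  obtain ⟨x₀, hx₀⟩ := Filter.eventually_atTop.mp (hS.and (hT.and (hR.and (eventually_gt_atTop 1))))
  refine ⟨C, x₀, fun x hx hxE => ?_⟩
  obtain ⟨hSx, hTx, hRx, hx1⟩ := hx₀ x hx
  have hSx := hSx hxE
  have hx1' : (1 : ℝ) < x := by exact_mod_cast hx1
  have hx0 : (0 : ℝ) < x := by linarith
  have hL : 0 < Real.log x := Real.log_pos hx1'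
  have hV0 : 0 ≤ sieveProduct x ((x : ℝ) ^ (1 / 10 : ℝ)) := sieveProduct_nonneg_of_even hxE _
  have hK0 : 0 ≤ 2 * Real.exp Real.eulerMascheroniConstant / (5 * (1 - 2 * t)) + t := by positivity
  -- the main term
  have hcoef := switched_coeff_le hG0 hG3 hc0 hc2 ht0 ht8
  have hmain : (2 * Real.exp Real.eulerMascheroniConstant / (5 * (1 - 2 * t)) + t) *
        #(switchedTriplesT x t) * sieveProduct x ((x : ℝ) ^ (1 / 10 : ℝ)) ≤
      (2 * Real.exp Real.eulerMascheroniConstant / 5 * switchingConstantTenth + ε) *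
        ((x : ℝ) * sieveProduct x ((x : ℝ) ^ (1 / 10 : ℝ)) / Real.log x) := by
    have h1 := mul_le_mul_of_nonneg_right (mul_le_mul_of_nonneg_left hTx hK0) hV0
    refine h1.trans ?_
    have e : (2 * Real.exp Real.eulerMascheroniConstant / (5 * (1 - 2 * t)) + t) *
          ((1 + t) ^ 2 * (switchingConstantTenth + t) * x / Real.log x) *
          sieveProduct x ((x : ℝ) ^ (1 / 10 : ℝ)) =
        ((2 * Real.exp Real.eulerMascheroniConstant / (5 * (1 - 2 * t)) + t) * (1 + t) ^ 2 *
            (switchingConstantTenth + t)) *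
          ((x : ℝ) * sieveProduct x ((x : ℝ) ^ (1 / 10 : ℝ)) / Real.log x) := by ring
    rw [e]
    refine mul_le_mul_of_nonneg_right ?_ (by positivity)
    linarith [hcoef]
  -- conclude
  exact hSx.trans (add_le_add hmain hRx)

/-- **Chen's Theorem I, PROVED** (discharge of `Literature.NumberTheory.Sieve.Chen.Chen1973_theoremI`):
every sufficiently large even `x` satisfies `P_x(1,2) ≥ 0.67 x C_x/(log x)²`
(Chen, Sci. Sinica 16 (1973), Theorem I). The assembly `Chen1973_theoremI_of` fed with the proved
estimates (A) `siftedCount_tenth_lower`, (B) `siftedCountDvd_tenth_sum_upper`,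
(C) `switchedSiftedCount_tenth_upper`, (V) `sieveProduct_tenth_lower` and the numerical inequality
`chen_theoremI_mainInequality`. [cite: ChenSciSinica1973, Theorem I] -/
theorem Chen1973_theoremI_holds : Chen1973_theoremI :=
  Chen1973_theoremI_of (a := lowerSieveFun 1 5)
    (b := ∫ β in (1 / 10 : ℝ)..(1 / 3), upperSieveFun 1 (5 - 10 * β) / β)
    (c := 2 * Real.exp Real.eulerMascheroniConstant / 5 * switchingConstantTenth)
    (fun _ hε => siftedCount_tenth_lower hε)
    (fun _ hε => siftedCountDvd_tenth_sum_upper hε)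
    (fun _ hε => switchedSiftedCount_tenth_upper hε)
    (fun _ hε => sieveProduct_tenth_lower hε)
    chen_theoremI_mainInequality

/-- **parity.S12 — `Literature.NumberTheory.Sieve.chen_goldbach` — PROVED, from Chen's Theorem I**:
every sufficiently large even `N` is `p + m` with `p` prime and `m` a product of at most two primes
(`chen_goldbach_of_theoremI` applied to `Chen1973_theoremI_holds`; declared with its absolute name in the
namespace of the fact). [cite: ChenSciSinica1973, Theorem I] -/
theorem _root_.Literature.NumberTheory.Sieve.chen_goldbach_holds :
    Literature.NumberTheory.Sieve.chen_goldbach :=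
  chen_goldbach_of_theoremI Chen1973_theoremI_holds

end Literature.NumberTheory.Sieve.Chen
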